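import Literature.AlgebraicGeometry.Resolution.KnafKuhlmann2009Prop310
import Literature.AlgebraicGeometry.Resolution.AbhyankarRationalUniformization
import Summits.ResolutionOfSingularities.ResolutionOfSingularities.Theorems.AbhyankarShadowsShadowsUniformizeDiscreteIsDenseIn
import Summits.ResolutionOfSingularities.ResolutionOfSingularities.Theorems.AbhyankarShadowsShadowsUniformizeUniformizerSeparating
import Summits.ResolutionOfSingularities.ResolutionOfSingularities.Theorems.AbhyankarShadowsShadowsUniformizeDenseTranscStep
import Summits.ResolutionOfSingularities.ResolutionOfSingularities.Theorems.AbhyankarShadowsShadowsUniformizeDenseAlgStep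
import HarnessLib

/-!
# Knaf–Kuhlmann 2009, Prop. 3.11 / Thm. 1.5 at discrete rational places — ambient form

Line `birth` of the crux `ShadowsUniformize` (stmt-ResolutionOfSingularities-16756, route
`AbhyankarShadows`), DISCRETE BRANCH, ambient half (lead c1), assembled from the landed stubs
`stub_discrete_isDenseIn`, `stub_uniformizer_separating`, `stub_denseTranscStep`,
`stub_denseAlgStep`.

Knaf–Kuhlmann 2009 (Adv. Math. 221 = arXiv:math/0702856), Thm. 1.5: "Let `(F|K,P)` be a valued
function field with the property that `(F,P)` lies in the completion of a subfunction field
`(F₀,P|_{F₀})` such that `P|_{F₀}` is an Abhyankar place of `F₀|K` […]. If `P|_K = id_K`, then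
`P` is strongly smoothly `K`-uniformizable"; its proof rests on Prop. 3.11: "Let `(L|K,P)` be a
finitely generated, separable extension within the completion of `(K,P)`. Then `P` is strongly
smoothly `O_K`-uniformizable." (§3.4, p. 14: induction on a separating transcendence basis with
Lemmas 2.16, 3.9 and Cor. 3.6, then "`L` must lie within the henselization of `K(T)`. Hence by
Lemma 3.7 …"). We PROVE the case needed by the crux: the Abhyankar subfield is `F₀ = k(t)` for a
uniformizer `t` of a DISCRETE RATIONAL place (cyclic value group, residue field the
algebraically closed — here: perfect — constants), in the ambient rendering of
`ValuedFunctionFields.lean` (one algebraically closed valued field `(Ω, V)`, subfields `k' ≤ K'`):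

* `isSmoothlyUniformizableIn_uniformizer_base` — the base of the tower: `k'(t)` is strongly
  smoothly uniformizable over the trivially valued `k' ⊆ O_V` (Knaf–Kuhlmann 2005 Thm. 1.1 for
  `ρ = 1, τ = 0`, `isSmoothlyUniformizableIn_rational`);
* `knafKuhlmann2009_thm15_discrete` — **Prop. 3.11 + Thm. 1.5, discrete rational case**: a
  separating tower led by an element `t'` of value `v t` (`stub_uniformizer_separating`,
  differential criterion), density of `k'(t')` in `K'` (`stub_discrete_isDenseIn`, `t'`-adic
  expansions), the dense transcendental steps (`stub_denseTranscStep` = Lemma 2.16 in the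
  completion case + Lemma 3.9) and the final dense finite separable step (`stub_denseAlgStep` =
  henselization + Hensel-root generator + Lemma 3.7 (2)), stacked by Cor. 3.6
  (`knafKuhlmann2009_cor36`).

No named facts are used. The typed pull-back to `K` is in
`AbhyankarShadowsShadowsUniformizeLurelDiscrete.lean`.

## Sources

* [KK09] H. Knaf, F.-V. Kuhlmann, *Every place admits local uniformization in a finite extension
  of the function field*, Adv. Math. 221 (2009) 428–453 = arXiv:math/0702856: Thm. 1.5 (p. 5),
  Prop. 3.11 and proof of Thm. 1.5 (§3.4, pp. 14–15 of the arXiv PDF). [KnafKuhlmann2009]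
* [KK05] H. Knaf, F.-V. Kuhlmann, *Abhyankar places admit local uniformization in any
  characteristic*, Ann. Sci. ÉNS 38 (2005), Thm. 1.1. [KnafKuhlmann2005]
-/

noncomputable section

-- single-problem summit: the doubled namespace component is forced
set_option linter.dupNamespace false

open Literature.AlgebraicGeometry.Resolution IsLocalRing

namespace Summit.ResolutionOfSingularities.ResolutionOfSingularities.Theorems

/-- **The base of the tower**: the rational function field `k'(t)` of an element of value `< 1`
is strongly smoothly uniformizable over the trivially valued constants `k' ⊆ O_V` (Knaf–Kuhlmann
2005, Thm. 1.1 for `ρ = 1`, `τ = 0`: `isSmoothlyUniformizableIn_rational`).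
[cite: KnafKuhlmann2005, Thm. 1.1] -/
theorem isSmoothlyUniformizableIn_uniformizer_base {Ω : Type} [Field Ω] (V : ValuationSubring Ω)
    (k' : Subfield Ω) (hkV : (k' : Set Ω) ⊆ V) {t : Ω} (ht0 : t ≠ 0) (ht1 : V.valuation t < 1)
    (Z : Finset Ω) (hZ : ∀ z ∈ Z, z ∈ V ∧ z ∈ Subfield.closure ((k' : Set Ω) ∪ {t})) :
    IsSmoothlyUniformizableIn ↥(V.toSubring ⊓ k'.toSubring) V
      (Subfield.closure ((k' : Set Ω) ∪ {t})) (Z : Set Ω) := by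
  classical
  have hkV' : ∀ c ∈ k', c ∈ V := fun c hc => hkV hc
  let x : Fin 1 → Ω := fun _ => t
  let y : Fin 0 → Ω := fun j => j.elim0
  have hy : ∀ j, y j ∈ V := fun j => j.elim0
  have hset : ((k' : Set Ω) ∪ (Set.range x ∪ Set.range y)) = (k' : Set Ω) ∪ {t} := by
    rw [Set.range_const, Set.range_eq_empty y, Set.union_empty]
  have hvt0 : V.valuation t ≠ 0 := (map_ne_zero V.valuation).mpr ht0
  have hxi : ∀ m : Fin 1 → ℤ,
      (∃ b ∈ k', (∏ i, V.valuation (x i) ^ (m i)) = V.valuation b) → m = 0 := by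
    rintro m ⟨b, hbk, hb⟩
    rw [Fin.prod_univ_one] at hb
    change V.valuation t ^ m 0 = V.valuation b at hb
    by_cases hb0 : b = 0
    · rw [hb0, map_zero] at hb
      exact absurd hb (zpow_ne_zero _ hvt0)
    · rw [valuation_eq_one_of_subfield_subset V hkV' hbk hb0,
        zpow_eq_one_iff_right₀ zero_le (ne_of_lt ht1)] at hb
      funext i
      fin_cases i
      exact hb
  have hri : AlgebraicIndependent (resField V k') (fun j => IsLocalRing.residue V ⟨y j, hy j⟩) :=
    algebraicIndependent_empty_type_iff.mpr
      (algebraMap (resField V k') (IsLocalRing.ResidueField V)).injective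
  have h := isSmoothlyUniformizableIn_rational V k' hkV' x y (fun _ => ht0) hxi hy hri Z
    (by rw [hset]; exact hZ)
  rw [hset] at h
  exact (isSmoothlyUniformizableIn_inf_iff V k' hkV _ _).mpr h

/-- **Knaf–Kuhlmann 2009, Prop. 3.11 with Thm. 1.5, discrete rational case, ambient form.** Let
`k' ≤ K'` be subfields of an algebraically closed valued field `(Ω, V)` with `k'` perfect and
`⊆ O_V`, `K'|k'` finitely generated, `t ∈ K'` a uniformizer (`t ≠ 0`, `v t < 1`, every non-zero
value of `K'` an integer power of `v t`) and `O_V ∩ K'` rational over `k'` (every element congruent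
to a constant). Then every finite `Z ⊆ O_V ∩ K'` is smoothly `O_{k'}`-uniformizable ("If
`P|_K = id_K`, then `P` is strongly smoothly `K`-uniformizable", Thm. 1.5, for the Abhyankar
subfield `F₀ = k(t)` in whose completion `K'` lies): separating tower led by `t'` with `v t' = v t`
(`stub_uniformizer_separating`), density of `k'(t')` (`stub_discrete_isDenseIn`), base
`isSmoothlyUniformizableIn_uniformizer_base`, dense transcendental steps (`stub_denseTranscStep`)
and the final dense finite separable step (`stub_denseAlgStep`), stacked by Cor. 3.6
(`knafKuhlmann2009_cor36`). [cite: KnafKuhlmann2009, Thm. 1.5 and Prop. 3.11] -/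
theorem knafKuhlmann2009_thm15_discrete
    {Ω : Type} [Field Ω] [IsAlgClosed Ω] (V : ValuationSubring Ω) (k' K' : Subfield Ω)
    [PerfectField k'] (t : Ω) (hkK : k' ≤ K') (hfg : FGOver k' K') (hkV : (k' : Set Ω) ⊆ V)
    (ht : t ∈ K') (ht0 : t ≠ 0) (ht1 : V.valuation t < 1)
    (hrat : ∀ y ∈ K', y ∈ V → ∃ c ∈ k', V.valuation (y - c) < 1)
    (hdisc : ∀ y ∈ K', y ≠ 0 → ∃ m : ℤ, V.valuation y = V.valuation t ^ m)
    (Z : Finset Ω) (hZ : ∀ z ∈ Z, z ∈ V ∧ z ∈ K') :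
    IsSmoothlyUniformizableIn ↥(V.toSubring ⊓ k'.toSubring) V K' (Z : Set Ω) := by
  classical
  -- the separating tower led by `t'`
  obtain ⟨t', n, x, ht'K, hvt', hxK, htransc, hfinsep⟩ :=
    stub_uniformizer_separating V k' K' t hkK hfg hkV ht ht1 hdisc
  have ht'1 : V.valuation t' < 1 := hvt' ▸ ht1
  have ht'0 : t' ≠ 0 := by
    intro h0
    rw [h0, map_zero] at hvt'
    exact (map_ne_zero V.valuation).mpr ht0 hvt'.symm
  have hdisc' : ∀ y ∈ K', y ≠ 0 → ∃ m : ℤ, V.valuation y = V.valuation t' ^ m := by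
    rw [hvt']; exact hdisc
  -- density of `k'(t')`
  have hdense : IsDenseIn V (Subfield.closure ((k' : Set Ω) ∪ {t'})) K' :=
    stub_discrete_isDenseIn V k' K' t' hkK hkV ht'K ht'1 hrat hdisc'
  -- the tower
  let E : ℕ → Subfield Ω := fun i =>
    Subfield.closure ((k' : Set Ω) ∪ insert t' (x '' {j : Fin n | (j : ℕ) < i}))
  have hE0 : E 0 = Subfield.closure ((k' : Set Ω) ∪ {t'}) := by
    simp only [E]
    congr
    rw [show {j : Fin n | (j : ℕ) < 0} = ∅ from
        Set.eq_empty_of_forall_notMem fun j hj => by simp at hj,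
      Set.image_empty, ← Set.singleton_def]
  have hkE : ∀ i, k' ≤ E i := fun i c hc => Subfield.subset_closure (Or.inl hc)
  have ht'E : ∀ i, t' ∈ E i := fun i => Subfield.subset_closure (Or.inr (Set.mem_insert _ _))
  have hE0le : ∀ i, Subfield.closure ((k' : Set Ω) ∪ {t'}) ≤ E i := by
    intro i
    refine Subfield.closure_le.mpr ?_
    rintro z (hz | hz)
    · exact hkE i hz
    · rw [Set.mem_singleton_iff.mp hz]; exact ht'E i
  have hEK : ∀ i, E i ≤ K' := by
    intro i
    refine Subfield.closure_le.mpr ?_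
    rintro z (hz | hz)
    · exact hkK hz
    · rcases Set.mem_insert_iff.mp hz with hz | ⟨j, -, rfl⟩
      · rw [hz]; exact ht'K
      · exact hxK j
  have hEmono : ∀ i, E i ≤ E (i + 1) := by
    intro i
    refine Subfield.closure_mono (Set.union_subset_union_right _ (Set.insert_subset_insert
      (Set.image_mono fun j (hj : (j : ℕ) < i) => ?_)))
    exact Nat.lt_succ_of_lt hj
  have hEstep : ∀ i : Fin n,
      E ((i : ℕ) + 1) = Subfield.closure (((E i : Subfield Ω) : Set Ω) ∪ {x i}) := by
    intro i
    refine le_antisymm ?_ ?_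
    · refine Subfield.closure_le.mpr ?_
      rintro z (hz | hz)
      · exact Subfield.subset_closure (Or.inl (hkE i hz))
      · rcases Set.mem_insert_iff.mp hz with hz | ⟨j, hj, rfl⟩
        · rw [hz]; exact Subfield.subset_closure (Or.inl (ht'E i))
        · change (j : ℕ) < i + 1 at hj
          rcases Nat.lt_succ_iff_lt_or_eq.mp hj with hj | hj
          · exact Subfield.subset_closure (Or.inl (Subfield.subset_closure
              (Or.inr (Set.mem_insert_of_mem _ ⟨j, hj, rfl⟩))))
          · rw [Fin.ext hj]
            exact Subfield.subset_closure (Or.inr rfl)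
    · refine Subfield.closure_le.mpr ?_
      rintro z (hz | hz)
      · exact hEmono i hz
      · rw [Set.mem_singleton_iff.mp hz]
        exact Subfield.subset_closure
          (Or.inr (Set.mem_insert_of_mem _ ⟨i, Nat.lt_succ_self _, rfl⟩))
  have hEtop : E n = Subfield.closure ((k' : Set Ω) ∪ insert t' (Set.range x)) := by
    simp only [E]
    congr
    ext z
    constructor
    · rintro ⟨j, -, rfl⟩; exact ⟨j, rfl⟩
    · rintro ⟨j, rfl⟩; exact ⟨j, j.2, rfl⟩
  -- density along the tower
  have hdenseE : ∀ i, ∀ F : Subfield Ω, F ≤ K' → IsDenseIn V (E i) F := by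
    intro i F hF y hy c hc hc0
    obtain ⟨z, hz, hlt⟩ := hdense y (hF hy) c (hF hc) hc0
    exact ⟨z, hE0le i hz, hlt⟩
  -- the induction
  have hQ : ∀ i, i ≤ n → ∀ Z : Finset Ω, (∀ z ∈ Z, z ∈ V ∧ z ∈ E i) →
      IsSmoothlyUniformizableIn ↥(V.toSubring ⊓ k'.toSubring) V (E i) (Z : Set Ω) := by
    intro i
    induction i with
    | zero =>
      intro _ Z hZ
      rw [hE0] at hZ ⊢
      exact isSmoothlyUniformizableIn_uniformizer_base V k' hkV ht'0 ht'1 Z hZ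
    | succ i ih =>
      intro hi Z hZ
      have hi' : i < n := Nat.lt_of_succ_le hi
      let i' : Fin n := ⟨i, hi'⟩
      refine knafKuhlmann2009_cor36 V (hkE i) (hEmono i) (ih hi'.le) ?_ Z hZ
      intro Z' hZ'
      have hstep := hEstep i'
      change E (i + 1) = _ at hstep
      rw [hstep] at hZ' ⊢
      refine stub_denseTranscStep V (E i) (x i') (fun P hP hP0 => htransc i' P (fun m => ?_) hP0)
        (hdenseE i _ (hstep ▸ hEK (i + 1))) Z' hZ'
      exact hP m
  -- the last, separable-algebraic step
  have hEn : E n ≤ K' := hEK n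
  refine knafKuhlmann2009_cor36 V (hkE n) hEn (hQ n le_rfl) ?_ Z hZ
  intro Z' hZ'
  refine stub_denseAlgStep V (E n) K' hEn ?_ (hdenseE n K' le_rfl) Z' hZ'
  rw [hEtop]
  exact hfinsep


end Summit.ResolutionOfSingularities.ResolutionOfSingularities.Theorems

end
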